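import Mathlib
import Literature.MathematicalPhysics.QuantumFieldTheory.Balaban1983to89.Beta.TorusG0Kernel

/-!
# Beta / EffectiveKernel — the unit-lattice effective kernel `K_eff = a − a² Q G₀ Q*` of the block-averaged
propagator ON THE TORUS TYPE: exact zero row sums, `η`- and volume-uniform exponential decay, row moments

HONEST FRAMING (verbatim, page 1 of everything this cell writes): discharging `BetaPertH` makes Bałaban's UV
stability UNCONDITIONAL — a real constructive-QFT result; it is NOT the continuum limit and NOT the Clay problem.
Gloss (BETA-SPEC v1.9b l. 17–18, G-ref2-14 (a) / G-ref2-20 (a)): «UNCONDITIONAL» in [Balaban1989LargeFieldII] (B16)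
p. 355's interval-hypothesis sense ONLY (`FlowStepRuns.p355Unconditional_of_partialSums` keeps `hnodes`); the located
leaves G-adv3-2 (left inequality of (0.1)/(2.50), d = 4), G-adv3-1 (U2 transfer of B14 Cor. 3's lower bound) and
`SecondExpLeaf` REMAIN.  THIS MODULE discharges nothing of that: it is a Mathlib-elementary certificate about ONE
scalar toy operator; nothing printed by Bałaban or King is asserted and no hypothesis is a quotation.

WHAT IS PROVED.  On the fine torus `T_η = Tor (fine (n+1) M)` (mesh `η = 1/(n+1)`, periods `(n+1)M_μ ≥ 3`) let
`H = torusOp n M a = −Δ^η + a Q*Q` (`Beta/TorusG0Decay`, p179998) and `G₀ = G0 n M a = H⁻¹` (`Beta/TorusG0Kernel`,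
p180050); `Q` = block averaging onto the unit torus `Tor M`, `Q*` = spreading (its adjoint for the `η^d`-weighted fine /
unit-weighted coarse pairings).  Integrating the fine field out of the Gaussian density
`exp(−½⟨f,(−Δ^η)f⟩_η − (a/2)‖ψ − Qf‖²)` leaves the unit-lattice quadratic form `½⟨ψ, K_eff ψ⟩` with the SCHUR
COMPLEMENT / PUSH-THROUGH kernel
  `K_eff = a·1 − a²·Q G₀ Q*`, i.e. `K_eff(b,b′) = a δ_{bb′} − a² (n+1)^{−d} Σ_{x∈B(b)} Σ_{x′∈B(b′)} G₀(x,x′)`   (`Keff n M a`).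
* §1 ABSTRACT PUSH-THROUGH ALGEBRA over any commutative ring: for `H = A + U B V` put
  `pushK A U B V := B − B V H⁻¹ U B`; if `A`, `B`, `H` are units then `(B⁻¹ + V A⁻¹ U) · pushK = 1` (`capacitance_mul_pushK`),
  hence `pushK = (B⁻¹ + V A⁻¹ U)⁻¹` (`pushK_eq_inv`) and the WOODBURY form `A⁻¹ − H⁻¹ = A⁻¹ U · pushK · V A⁻¹`
  (`inv_sub_inv_eq_pushK`); unconditionally in `A`, `V H⁻¹ U = B⁻¹ − B⁻¹ · pushK · B⁻¹` (`V_inv_U_eq`).  This is the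
  dictionary to the cell's (D1): wherever the free propagator `C = A⁻¹` exists, `pushK` IS the middle factor `K_eff` of
  the Woodbury remainder `R_W = C Q* K_eff Q C`; on the torus (`−Δ^η` has the zero mode) `pushK` is still defined and
  `Keff = (n+1)^d • pushK (lap c) indᵀ ((a/(n+1)^d)•1) ind` (`Keff_eq_pushK`; the factor `(n+1)^d = η^{−d}` is the
  counting-vs-`η^d`-measure normalisation of the unit field).
* §2 the objects on the torus: the block indicator matrix `ind`, `torusOp = lap c + (a/(n+1)^d) • indᵀ ind`
  (`torusOp_eq`), `Keff`, its entry formula (`Keff_apply`), symmetry (`Keff_transpose`).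
* §3 (K1) **EXACT ZERO ROW SUMS** `Σ_{b′} K_eff(b,b′) = 0` for every `b` (`Keff_rowsum`; from `H 1 = a 1`, i.e.
  `G₀ 1 = a⁻¹ 1`, `G0_mulVec_one`) — the `cancel` input `∀ y, Σ_{y′} K y y′ = 0` of `Beta/BulkParametrix.ParametrixInputsW`,
  exact on the torus for THIS object (no defect term); also `K_eff 1 = 0` (`Keff_mulVec_one`).
* §4 (K2) **DECAY, UNIFORM IN THE MESH AND IN THE VOLUME**: for `0 ≤ δ ≤ 1` with the `η`-free smallness
  `2d δ² + a(e^δ − 1) ≤ min(2,a)/2` of `TorusG0Decay`,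
  `|K_eff(b,b′) − a δ_{bb′}| ≤ a² (2/min(2,a)) e^{δ} · e^{−δ·ldist_M(b,b′)}` (`Keff_entry_bound`), `ldist_M` = the sup
  circular distance of the unit torus `Tor M`.  Mechanism: the BLOCK–BLOCK matrix element `⟨1_{B(b)}, G₀ 1_{B(b′)}⟩` is
  bounded by the `ℓ²` set-to-set decay `G0_setDecay` and Cauchy–Schwarz (`blockSum_G0_abs_le`) — for block-averaged
  quantities the `ℓ²` operator bound loses nothing, so NO pointwise / elliptic-regularity input is needed (contrast the
  «no η² gain» disclaimer of `TorusG0Kernel`); the geometric input is `ldist_M(b,b′) ≤ edist(x,x′) + 1` for `x ∈ B(b)`,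
  `x′ ∈ B(b′)` (`ldist_blocks_le`, from the scaling inequality `s·dist(δ,Nℤ) ≤ dist(sδ + t, sNℤ) + |t|`, `circAbs_scale`).
* §5 (K3) **ROW MOMENTS, UNIFORM IN `k` AND THE VOLUME**: for `δ > 0` as above and any weight
  `0 ≤ w(b,b′) ≤ C_w e^{(δ/2) ldist_M(b,b′)}`: `Σ_{b′} |K_eff(b,b′)| w(b,b′) ≤ a·w(b,b) + a²(2/min(2,a)) e^{δ} C_w K_d(δ/2)`
  (`Keff_weighted_rowsum`, `K_d` = `B4Sect5Proof.latticeConst`, via pv09's period-free torus sum `B4Sect5Torus.torusSum_le`);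
  in particular `Σ_{b′} |K_eff(b,b′)| (1 + ldist_M(b,b′))^q ≤ kappaRow d q a δ` (`Keff_moment`, explicit constant) — the
  `moment` inputs of `ParametrixInputsW` / `TwoLegInputs` (weights `ρ(1+P)`, `P`) for THIS kernel, with `k`-free constants.
* §6 (K4) `K_eff` is a legitimate massless unit-lattice kinetic term: `0 ≤ ⟨ψ, K_eff ψ⟩ ≤ a‖ψ‖²` for all `a > 0`
  (`Keff_form_nonneg`, `Keff_form_le`; variational Schur-complement argument, no `a ≤ 2` restriction).
* §7 non-vacuity: `deltaStd d a := min(2,a)/(4(d + a + 1)) ∈ (0,1]` satisfies the smallness condition for EVERY `a > 0`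
  (`deltaStd_pos`, `deltaStd_le_one`, `deltaStd_small`), so (K2)/(K3) hold with a definite rate at every `a`.
CONSUMER DICTIONARY (cell ruling R5 «deliver slots as instances»; MISSING-B12 §12.2 (i)): with `Y := Tor M`,
`Keff := Keff n M a`, `P b b′ := (1 + ldist_M(b,b′))^q`, the fields `cancel : ∀ y, Σ_{y′} Keff y y′ = 0` (`Keff_rowsum`)
and `moment : ∀ y, Σ_{y′} |Keff y y′| · (weight) ≤ κ` (`Keff_moment`, `Keff_weighted_rowsum`) of
`Beta/BulkParametrix.ParametrixInputsW` / `TwoLegInputs` hold for THIS kernel with `k`- and volume-free constants; the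
LEG fields (`legA`, `legB`, `lipschitzW`, `blockSumsW`, `pair`, the Peetre field for the chosen weight) concern the
free legs `∇C Q*`, `Q C ∇′` and the weight bookkeeping and are NOT addressed here — this file builds no instance of those
structures and does not import `BulkParametrix` (see (iii) below for why the carriers do not yet match).

WHAT IT DOES NOT GIVE (located, not claimed).  (i) Only the SCALAR, `U = 1`, SITE-block-averaged model with unit
weights: Bałaban's averaging for gauge fields (B12 (0.11)–(0.12)) is per bond and per component, and the covariant /
background-field operators `Δ_k(U)` are not touched; for bond fields the same algebra applies verbatim but the decay
input then needs the divergence-form Poincaré inequality (not in the tree).  (ii) No statement about the ACTUAL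
polarization operator `Π_{k+1}` of B12 (2.29), about `β`, its sign, or `κ = kappaBal` (cell records G-beta-4, THE HEART).
(iii) The infinite-volume legs `∇C Q*`, `Q C ∇′` of the cell's (T1) live on `ℤ⁴` while `Keff` lives on the torus; the
common carrier (torus legs, or the `T ↗ ℤ^d` limit of `Keff` which B12 p. 264 takes before defining `β_{j+1}`) is NOT
built here.  (iv) `ker K_eff = constants` (connectedness) is not proved, only `K_eff 1 = 0` and `K_eff ≥ 0`.
CONTEXT ONLY (printed TYPE of statement, never used as a fact): uniform-in-`k` boundedness / exponential localisation of
the effective unit-lattice operators — King, *The U(1) Higgs model. I*, Commun. Math. Phys. 102 (1986) 649–677, Prop. 3.10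
(3.91) p. 669 «uniformly in k» [King1986] (LOCATOR CORRECTED, docstring only, b2b-balaban-beta-an5 gen 15 after asym1's NOTE
«KING 1986 LOCATOR SLIP»: gen 4 printed Part II's volume «103» and a bib key `King1986U1Higgs3dI` that does not exist in
`references.bib`; display, proposition and page are Part I's, re-checked on the held text layer p. 669; nothing was or is cited
as a fact); Bałaban, Commun. Math. Phys. 89 (1983) 571–597, Lemma 2.4 (2.35)–(2.37) p. 582
[Balaban1983RegularityDecay]; the operator `−Δ^η + aQ*Q` is that of B5 = Commun. Math. Phys. 95 (1984) (1.18) p. 20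
[Balaban1984PropagatorsI].  Devices: Schur complement / Woodbury–push-through identity [folklore] (Mathlib
`Matrix.add_mul_mul_inv_eq_sub`); Combes–Thomas [CombesThomas1973, §II] via the imported modules.
Cell records: AN5.md §2.4 rows B7b / B8 / B7c (this module turns their «OPEN as a statement for this kernel» into
kernel theorems for the scalar site model), MISSING-B12 §12.2 (i), BETA-SPEC §8.6 (L1)(β).  Unit `b2b-balaban-beta-an5-g4`
(DEDICATED β sub-cell row BETA-an5, gen 4; journal claim BETA-an5-KEFF-DECAY); staged byte-identically under
`HOME/lean/BalabanYm4/`.  Value = kernel certificate of a located step for a toy operator, NOT summit progress.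
-/

open Finset Matrix

namespace Literature.MathematicalPhysics.QuantumFieldTheory.Balaban1983to89.Beta.EffectiveKernel

/-! ## §1  Abstract push-through / Schur-complement algebra -/

section PushThrough

variable {R : Type*} [CommRing R] {X Y : Type*} [Fintype X] [Fintype Y] [DecidableEq X] [DecidableEq Y]

/-- **The push-through kernel** of `H = A + U B V`: `pushK A U B V = B − B V H⁻¹ U B` (defined for every `A`; when
the "free part" `A` is a unit it is `(B⁻¹ + V A⁻¹ U)⁻¹`, `pushK_eq_inv`).  In the cell's dictionary: `A = −Δ` (fine),
`U = Q*`, `B = a`, `V = Q`, and `pushK = K_eff`, the middle factor of the Woodbury remainder. [folklore] -/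
noncomputable def pushK (A : Matrix X X R) (U : Matrix X Y R) (B : Matrix Y Y R) (V : Matrix Y X R) :
    Matrix Y Y R :=
  B - B * V * (A + U * B * V)⁻¹ * U * B

omit [DecidableEq Y] in
/-- unfolding lemma. [folklore] -/
theorem pushK_def (A : Matrix X X R) (U : Matrix X Y R) (B : Matrix Y Y R) (V : Matrix Y X R) :
    pushK A U B V = B - B * V * (A + U * B * V)⁻¹ * U * B := rfl

/-- **`(B⁻¹ + V A⁻¹ U) · pushK = 1`** whenever `A`, `B` and `H = A + U B V` are units. [folklore] -/
theorem capacitance_mul_pushK {A : Matrix X X R} {U : Matrix X Y R} {B : Matrix Y Y R} {V : Matrix Y X R}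
    (hA : IsUnit A) (hB : IsUnit B) (hH : IsUnit (A + U * B * V)) :
    (B⁻¹ + V * A⁻¹ * U) * pushK A U B V = 1 := by
  have hA' : A⁻¹ * A = 1 := Matrix.nonsing_inv_mul _ ((Matrix.isUnit_iff_isUnit_det _).mp hA)
  have hB' : B⁻¹ * B = 1 := Matrix.nonsing_inv_mul _ ((Matrix.isUnit_iff_isUnit_det _).mp hB)
  have hH' : (A + U * B * V) * (A + U * B * V)⁻¹ = 1 :=
    Matrix.mul_nonsing_inv _ ((Matrix.isUnit_iff_isUnit_det _).mp hH)
  have hBc : ∀ Z : Matrix Y Y R, B⁻¹ * (B * Z) = Z := fun Z => by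
    rw [← Matrix.mul_assoc, hB', Matrix.one_mul]
  -- the one non-trivial step: `A⁻¹ (U B) = H⁻¹ (U B) + A⁻¹ U B V H⁻¹ (U B)` (insert `H H⁻¹ = 1` and expand `H`)
  have key : A⁻¹ * (U * B) = (A + U * B * V)⁻¹ * (U * B)
      + A⁻¹ * (U * (B * (V * ((A + U * B * V)⁻¹ * (U * B))))) := by
    have e1 : A⁻¹ * (U * B) = A⁻¹ * ((A + U * B * V) * ((A + U * B * V)⁻¹ * (U * B))) := by
      rw [← Matrix.mul_assoc (A + U * B * V), hH', Matrix.one_mul]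
    rw [e1, Matrix.add_mul, Matrix.mul_add, ← Matrix.mul_assoc A⁻¹ A, hA', Matrix.one_mul]
    simp only [Matrix.mul_assoc]
  rw [pushK_def]
  simp only [Matrix.add_mul, Matrix.mul_sub, Matrix.mul_assoc, hBc, hB']
  rw [key]
  simp only [Matrix.mul_add, Matrix.mul_assoc]
  abel

/-- the capacitance matrix `B⁻¹ + V A⁻¹ U` is then a unit. [folklore] -/
theorem isUnit_capacitance {A : Matrix X X R} {U : Matrix X Y R} {B : Matrix Y Y R} {V : Matrix Y X R}
    (hA : IsUnit A) (hB : IsUnit B) (hH : IsUnit (A + U * B * V)) : IsUnit (B⁻¹ + V * A⁻¹ * U) :=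
  (Matrix.isUnit_iff_isUnit_det _).mpr (Matrix.isUnit_det_of_right_inverse (capacitance_mul_pushK hA hB hH))

/-- **`pushK = (B⁻¹ + V A⁻¹ U)⁻¹`** when `A`, `B`, `H` are units. [folklore] -/
theorem pushK_eq_inv {A : Matrix X X R} {U : Matrix X Y R} {B : Matrix Y Y R} {V : Matrix Y X R}
    (hA : IsUnit A) (hB : IsUnit B) (hH : IsUnit (A + U * B * V)) :
    pushK A U B V = (B⁻¹ + V * A⁻¹ * U)⁻¹ :=
  (Matrix.inv_eq_right_inv (capacitance_mul_pushK hA hB hH)).symm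

/-- **The Woodbury remainder has `pushK` as its middle factor**: `A⁻¹ − (A + UBV)⁻¹ = A⁻¹ U · pushK · V A⁻¹` when
`A`, `B`, `H` are units (Mathlib's Woodbury identity `Matrix.add_mul_mul_inv_eq_sub` + `pushK_eq_inv`).  In the
cell's notation: `C − G₀ = R_W = C Q* K_eff Q C`. [folklore] -/
theorem inv_sub_inv_eq_pushK {A : Matrix X X R} {U : Matrix X Y R} {B : Matrix Y Y R} {V : Matrix Y X R}
    (hA : IsUnit A) (hB : IsUnit B) (hH : IsUnit (A + U * B * V)) :
    A⁻¹ - (A + U * B * V)⁻¹ = A⁻¹ * U * pushK A U B V * V * A⁻¹ := by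
  rw [Matrix.add_mul_mul_inv_eq_sub A U B V hA hB (isUnit_capacitance hA hB hH), pushK_eq_inv hA hB hH]
  abel

/-- unconditionally in `A`: **`V H⁻¹ U = B⁻¹ − B⁻¹ · pushK · B⁻¹`** for a unit `B` — the block–block covariance of the
fine field in terms of `K_eff` (`Q G₀ Q* = a⁻¹ − a⁻² K_eff`). [folklore] -/
theorem V_inv_U_eq {A : Matrix X X R} {U : Matrix X Y R} {B : Matrix Y Y R} {V : Matrix Y X R} (hB : IsUnit B) :
    V * (A + U * B * V)⁻¹ * U = B⁻¹ - B⁻¹ * pushK A U B V * B⁻¹ := by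
  have hB' : B⁻¹ * B = 1 := Matrix.nonsing_inv_mul _ ((Matrix.isUnit_iff_isUnit_det _).mp hB)
  have hB'' : B * B⁻¹ = 1 := Matrix.mul_nonsing_inv _ ((Matrix.isUnit_iff_isUnit_det _).mp hB)
  have hBc : ∀ Z : Matrix Y Y R, B⁻¹ * (B * Z) = Z := fun Z => by
    rw [← Matrix.mul_assoc, hB', Matrix.one_mul]
  rw [pushK_def]
  simp only [Matrix.mul_sub, Matrix.sub_mul, Matrix.mul_assoc, hBc, hB'', Matrix.mul_one]
  abel

end PushThrough

/-! ## §2  The objects on the torus: block indicator, `torusOp = lap + (a/(n+1)^d) indᵀ ind`, `Keff` -/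

noncomputable section

open B5Prop11Plancherel (Tor fine unitVec)
open B5Block118 (bpt)
open B5Blocks16 (bpt_val)
open B4TorusKernel.MultiPeriod (circAbs centre circAbs_le_abs circAbs_nonneg circAbs_add_mul abs_add_mul_centre)
open B4Sect5Torus (TSite ccoord tdist tdist_nonneg circAbs_le_tdist torusSum_le)
open B4Sect5Proof (latticeConst latticeConst_nonneg)
open CombesThomasForm (lap lap_apply lap_mulVec lap_form)
open TorusG0Decay (torusOp coupling coupling_symm coupling_nonneg coercive_torus edist ldist ldist_self ldist_symm
  toSite one_le card_block exists_eq_bpt sum_blockInd_sq ldist_le_of_forall)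
open TorusG0Kernel (G0 G0_transpose torusOp_mulVec_G0 G0_mulVec_torusOp G0_setDecay G0_form_nonneg)

variable {d : ℕ} (n : ℕ) (M : Fin d → ℕ) [hM : ∀ μ, NeZero (M μ)]

/-- the block indicator matrix `ind b x = 1_{B(b)}(x)` (unit torus `Tor M` × fine torus `T_η`); as a function of `x`,
`ind b` is the indicator of the block `B(b)`; `Q = (n+1)^{−d} · ind` is block averaging, `Q* = indᵀ` spreading.
[folklore] -/
def ind : Matrix (Tor M) (Tor (fine (n + 1) M)) ℝ := fun b x =>
  if B5Blocks16.blockOf (n + 1) M x = b then 1 else 0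

/-- unfolding lemma for `ind`. [folklore] -/
theorem ind_apply (b : Tor M) (x : Tor (fine (n + 1) M)) :
    ind n M b x = if B5Blocks16.blockOf (n + 1) M x = b then 1 else 0 := rfl

/-- `Σ_b ind b x = 1`: every fine site lies in exactly one block. [folklore] -/
theorem sum_ind (x : Tor (fine (n + 1) M)) : ∑ b, ind n M b x = 1 := by
  simp only [ind_apply, Finset.sum_ite_eq, Finset.mem_univ, if_true]

/-- **`torusOp = lap c + (a/(n+1)^d) • indᵀ ind`** (`c = (n+1)²` on nearest neighbours): the block part of
`H = −Δ^η + aQ*Q` is `a Q*Q = (a/(n+1)^d) indᵀ ind` since every block has `(n+1)^d` sites. [folklore] -/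
theorem torusOp_eq (a : ℝ) : torusOp n M a =
    lap (coupling (fine (n + 1) M) (((n : ℝ) + 1) ^ 2)) + (a / ((n : ℝ) + 1) ^ d) • ((ind n M)ᵀ * ind n M) := by
  ext j k
  rw [Matrix.add_apply, Matrix.smul_apply, Matrix.mul_apply, smul_eq_mul, Finset.mul_sum]
  simp only [torusOp, Matrix.transpose_apply, ind_apply]
  congr 1
  refine Finset.sum_congr rfl fun b _ => ?_
  rw [card_block]; push_cast; ring

/-- **The effective unit-lattice kernel** `K_eff = a·1 − a² Q G₀ Q* = a·1 − (a²/(n+1)^d) · ind G₀ indᵀ` on the unit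
torus `Tor M` (the Schur complement of the fine block of the joint precision of `(f, ψ)`; OUR definition, context
B12 §1 / King §3 — nothing printed is asserted). [folklore] -/
def Keff (a : ℝ) : Matrix (Tor M) (Tor M) ℝ :=
  a • (1 : Matrix (Tor M) (Tor M) ℝ) - (a ^ 2 / ((n : ℝ) + 1) ^ d) • (ind n M * G0 n M a * (ind n M)ᵀ)

/-- **dictionary to §1**: `Keff = (n+1)^d • pushK (lap c) indᵀ ((a/(n+1)^d) • 1) ind`, i.e. `K_eff` is `η^{−d}` times
the push-through kernel of `H = lap c + indᵀ ((a/(n+1)^d)•1) ind` in the counting-measure normalisation (the factor is the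
`η^d`-weighted vs counting pairing of the unit field). [folklore] -/
theorem Keff_eq_pushK (a : ℝ) : Keff n M a = ((n : ℝ) + 1) ^ d •
    pushK (lap (coupling (fine (n + 1) M) (((n : ℝ) + 1) ^ 2))) (ind n M)ᵀ
      ((a / ((n : ℝ) + 1) ^ d) • (1 : Matrix (Tor M) (Tor M) ℝ)) (ind n M) := by
  have hm : ((n : ℝ) + 1) ^ d ≠ 0 := by positivity
  have hH : lap (coupling (fine (n + 1) M) (((n : ℝ) + 1) ^ 2))
      + (ind n M)ᵀ * ((a / ((n : ℝ) + 1) ^ d) • (1 : Matrix (Tor M) (Tor M) ℝ)) * ind n M = torusOp n M a := by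
    rw [torusOp_eq, Matrix.mul_smul, Matrix.mul_one, Matrix.smul_mul]
  rw [pushK_def, hH]
  have hG : (torusOp n M a)⁻¹ = G0 n M a := rfl
  rw [hG]
  ext b b'
  simp only [Keff, Matrix.sub_apply, Matrix.smul_apply, smul_eq_mul, Matrix.smul_mul, Matrix.mul_smul,
    Matrix.one_mul, Matrix.mul_one, Matrix.one_apply]
  by_cases h : b = b'
  · simp only [h, if_true]; field_simp
  · simp only [h, if_false]; field_simp

/-- the entries of `ind G₀ indᵀ` are the block–block sums `Σ_{x∈B(b)} (G₀ 1_{B(b′)})(x)`. [folklore] -/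
theorem indGind_apply (a : ℝ) (b b' : Tor M) :
    (ind n M * G0 n M a * (ind n M)ᵀ) b b'
      = ∑ x ∈ univ.filter (fun x => B5Blocks16.blockOf (n + 1) M x = b), (G0 n M a).mulVec (ind n M b') x := by
  rw [Finset.sum_filter]
  simp only [Matrix.mul_apply, Matrix.transpose_apply, mulVec, dotProduct, Finset.sum_mul]
  rw [Finset.sum_comm]
  refine Finset.sum_congr rfl fun x _ => ?_
  by_cases hx : B5Blocks16.blockOf (n + 1) M x = b
  · rw [if_pos hx]
    refine Finset.sum_congr rfl fun x' _ => ?_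
    rw [ind_apply n M b x, if_pos hx, one_mul]
  · rw [if_neg hx]
    refine Finset.sum_eq_zero fun x' _ => ?_
    rw [ind_apply n M b x, if_neg hx, zero_mul, zero_mul]

/-- **entry formula**: `K_eff(b,b′) = a δ_{bb′} − (a²/(n+1)^d) Σ_{x∈B(b)} (G₀ 1_{B(b′)})(x)`. [folklore] -/
theorem Keff_apply (a : ℝ) (b b' : Tor M) :
    Keff n M a b b' = (if b = b' then a else 0)
      - a ^ 2 / ((n : ℝ) + 1) ^ d
        * ∑ x ∈ univ.filter (fun x => B5Blocks16.blockOf (n + 1) M x = b), (G0 n M a).mulVec (ind n M b') x := by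
  rw [Keff, Matrix.sub_apply, Matrix.smul_apply, Matrix.smul_apply, Matrix.one_apply, indGind_apply, smul_eq_mul,
    smul_eq_mul, mul_ite, mul_one, mul_zero]

/-- `K_eff` is symmetric. [folklore] -/
theorem Keff_transpose (a : ℝ) : (Keff n M a)ᵀ = Keff n M a := by
  simp only [Keff, Matrix.transpose_sub, Matrix.transpose_smul, Matrix.transpose_one, Matrix.transpose_mul,
    Matrix.transpose_transpose, G0_transpose, Matrix.mul_assoc]

/-! ## §3  (K1) Exact zero row sums: `Σ_{b′} K_eff(b,b′) = 0`, `K_eff 1 = 0` -/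

/-- `H c = a c` on constants: `−Δ^η` kills constants and `Q*Q 1 = 1`. [folklore] -/
theorem torusOp_mulVec_const (a c : ℝ) :
    (torusOp n M a).mulVec (fun _ => c) = fun _ => a * c := by
  have hm : ((n : ℝ) + 1) ^ d ≠ 0 := by positivity
  rw [torusOp_eq, Matrix.add_mulVec, Matrix.smul_mulVec, ← Matrix.mulVec_mulVec]
  funext x
  simp only [Pi.add_apply, Pi.smul_apply, smul_eq_mul, lap_mulVec, sub_self, mul_zero, Finset.sum_const_zero,
    zero_add]
  have h1 : (ind n M).mulVec (fun _ => c) = fun b => ((n : ℝ) + 1) ^ d * c := by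
    funext b
    simp only [mulVec, dotProduct, ind_apply, ite_mul, one_mul, zero_mul, Finset.sum_ite, Finset.sum_const_zero,
      add_zero, Finset.sum_const, nsmul_eq_mul, card_block]
    push_cast; ring
  rw [h1]
  simp only [mulVec, dotProduct, Matrix.transpose_apply, ind_apply, ite_mul, one_mul, zero_mul, Finset.sum_ite_eq,
    Finset.mem_univ, if_true]
  field_simp

/-- **`G₀ 1 = a⁻¹ 1`**. [folklore] -/
theorem G0_mulVec_one (h3 : ∀ μ, 3 ≤ fine (n + 1) M μ) {a : ℝ} (ha : 0 < a) :
    (G0 n M a).mulVec (fun _ => (1 : ℝ)) = fun _ => a⁻¹ := by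
  have h := G0_mulVec_torusOp n M h3 ha (fun _ => a⁻¹)
  rw [torusOp_mulVec_const, mul_inv_cancel₀ ha.ne'] at h
  exact h

/-- **(K1) exact zero row sums**: `Σ_{b′} K_eff(b,b′) = 0` for every unit site `b` — the `cancel` field
`∀ y, Σ_{y′} K y y′ = 0` of `Beta/BulkParametrix.ParametrixInputsW`, EXACT on the torus for this kernel. [folklore] -/
theorem Keff_rowsum (h3 : ∀ μ, 3 ≤ fine (n + 1) M μ) {a : ℝ} (ha : 0 < a) (b : Tor M) :
    ∑ b', Keff n M a b b' = 0 := by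
  have hm : ((n : ℝ) + 1) ^ d ≠ 0 := by positivity
  simp only [Keff_apply, Finset.sum_sub_distrib, Finset.sum_ite_eq, Finset.mem_univ, if_true, ← Finset.mul_sum]
  rw [Finset.sum_comm]
  have hlin : ∀ x, ∑ b', (G0 n M a).mulVec (ind n M b') x = (G0 n M a).mulVec (fun _ => (1 : ℝ)) x := by
    intro x
    simp only [mulVec, dotProduct]
    rw [Finset.sum_comm]
    refine Finset.sum_congr rfl fun x' _ => ?_
    rw [← Finset.mul_sum, sum_ind]
  simp only [hlin, G0_mulVec_one n M h3 ha, Finset.sum_const, nsmul_eq_mul, card_block]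
  push_cast
  field_simp
  ring

/-- `Σ_b K_eff(b,b′) = 0` (column sums, by symmetry). [folklore] -/
theorem Keff_colsum (h3 : ∀ μ, 3 ≤ fine (n + 1) M μ) {a : ℝ} (ha : 0 < a) (b' : Tor M) :
    ∑ b, Keff n M a b b' = 0 := by
  have h := Keff_rowsum n M h3 ha b'
  calc ∑ b, Keff n M a b b' = ∑ b, (Keff n M a)ᵀ b' b := by simp only [Matrix.transpose_apply]
    _ = 0 := by rw [Keff_transpose]; exact h

/-- **`K_eff 1 = 0`**: the constants are zero modes (`K̂_eff(0) = 0`). [folklore] -/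
theorem Keff_mulVec_one (h3 : ∀ μ, 3 ≤ fine (n + 1) M μ) {a : ℝ} (ha : 0 < a) :
    (Keff n M a).mulVec (fun _ => (1 : ℝ)) = 0 := by
  funext b
  simp only [mulVec, dotProduct, mul_one, Pi.zero_apply]
  exact Keff_rowsum n M h3 ha b

/-! ## §4  (K2) Block separation and the `η`-, volume-uniform entry decay -/

/-- **scaling inequality for circular distances**: `s · dist(δ, Nℤ) ≤ dist(sδ + t, sNℤ) + |t|` (`N, s ≥ 1`).
[folklore] -/
theorem circAbs_scale {N s : ℕ} (hN : 1 ≤ N) (hs : 1 ≤ s) (δ t : ℤ) :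
    (s : ℤ) * circAbs N δ ≤ circAbs (s * N) (s * δ + t) + |t| := by
  set m := centre (s * N) (s * δ + t) with hm
  have hsN : 1 ≤ s * N := Nat.mul_le_mul hs hN
  have h1 : |s * δ + t + ((s * N : ℕ) : ℤ) * m| = circAbs (s * N) (s * δ + t) := abs_add_mul_centre hsN _
  have h2 : circAbs N (δ + N * m) = circAbs N δ := circAbs_add_mul N δ m
  have h3 : circAbs N (δ + N * m) ≤ |δ + N * m| := circAbs_le_abs hN _
  have h4 : (s : ℤ) * |δ + N * m| = |(s * δ + t + ((s * N : ℕ) : ℤ) * m) - t| := by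
    rw [← abs_of_nonneg (show (0 : ℤ) ≤ s by positivity), ← abs_mul, abs_of_nonneg (show (0 : ℤ) ≤ s by positivity)]
    congr 1; push_cast; ring
  have h5 : |(s * δ + t + ((s * N : ℕ) : ℤ) * m) - t| ≤ |s * δ + t + ((s * N : ℕ) : ℤ) * m| + |t| := abs_sub _ _
  calc (s : ℤ) * circAbs N δ = s * circAbs N (δ + N * m) := by rw [h2]
    _ ≤ s * |δ + N * m| := mul_le_mul_of_nonneg_left h3 (by positivity)
    _ ≤ circAbs (s * N) (s * δ + t) + |t| := by rw [h4, ← h1]; exact h5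

/-- **block separation**: two fine sites in blocks `b`, `b′` are at physical torus distance
`edist(x,x′) ≥ ldist_M(b,b′) − 1` (in fact `− n/(n+1)`), `ldist_M` = sup circular distance of the unit torus. [folklore] -/
theorem ldist_blocks_le (b b' : Tor M) {x t : Tor (fine (n + 1) M)}
    (hx : B5Blocks16.blockOf (n + 1) M x = b) (ht : B5Blocks16.blockOf (n + 1) M t = b') :
    ldist M b b' ≤ edist n M x t + 1 := by
  obtain ⟨y, rfl⟩ := exists_eq_bpt n M hx
  obtain ⟨y', rfl⟩ := exists_eq_bpt n M ht
  have hn1 : (0 : ℝ) < (n : ℝ) + 1 := by positivity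
  have he0 : 0 ≤ edist n M (bpt (n + 1) M b y) (bpt (n + 1) M b' y') := by
    unfold TorusG0Decay.edist TorusG0Decay.ldist
    exact mul_nonneg (by positivity) (tdist_nonneg _ _ _)
  -- per coordinate: `circAbs_M ≤ edist + 1`
  have hcoord : ∀ i, (circAbs (M i) (((b i).val : ℤ) - ((b' i).val : ℤ)) : ℝ)
      ≤ edist n M (bpt (n + 1) M b y) (bpt (n + 1) M b' y') + 1 := by
    intro i
    have hs : 1 ≤ n + 1 := by omega
    have key := circAbs_scale (one_le M i) hs (((b i).val : ℤ) - ((b' i).val : ℤ))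
      (((y i : ℕ) : ℤ) - ((y' i : ℕ) : ℤ))
    have e : ((n + 1 : ℕ) : ℤ) * (((b i).val : ℤ) - ((b' i).val : ℤ)) + (((y i : ℕ) : ℤ) - ((y' i : ℕ) : ℤ))
        = ((bpt (n + 1) M b y i).val : ℤ) - ((bpt (n + 1) M b' y' i).val : ℤ) := by
      rw [bpt_val, bpt_val]; push_cast; ring
    rw [e] at key
    have hfine : (circAbs (fine (n + 1) M i)
        (((bpt (n + 1) M b y i).val : ℤ) - ((bpt (n + 1) M b' y' i).val : ℤ)) : ℝ)
        ≤ ldist (fine (n + 1) M) (bpt (n + 1) M b y) (bpt (n + 1) M b' y') :=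
      circAbs_le_tdist (one_le (fine (n + 1) M)) (toSite (fine (n + 1) M) (bpt (n + 1) M b y))
        (toSite (fine (n + 1) M) (bpt (n + 1) M b' y')) i
    have hty : |(((y i : ℕ) : ℤ) - ((y' i : ℕ) : ℤ))| ≤ n := by
      have h1 := (y i).is_lt
      have h2 := (y' i).is_lt
      rw [abs_le]; constructor <;> omega
    have keyR : ((n : ℝ) + 1) * (circAbs (M i) (((b i).val : ℤ) - ((b' i).val : ℤ)) : ℝ)
        ≤ (circAbs (fine (n + 1) M i)
            (((bpt (n + 1) M b y i).val : ℤ) - ((bpt (n + 1) M b' y' i).val : ℤ)) : ℝ) + n := by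
      have := key.trans (add_le_add le_rfl hty)
      have := (Int.cast_le (R := ℝ)).mpr this
      push_cast at this
      exact this
    have hed : edist n M (bpt (n + 1) M b y) (bpt (n + 1) M b' y')
        = (1 / ((n : ℝ) + 1)) * ldist (fine (n + 1) M) (bpt (n + 1) M b y) (bpt (n + 1) M b' y') := rfl
    rw [hed]
    refine le_of_mul_le_mul_left ?_ hn1
    have e2 : ((n : ℝ) + 1) * (1 / ((n : ℝ) + 1) * ldist (fine (n + 1) M) (bpt (n + 1) M b y) (bpt (n + 1) M b' y') + 1)
        = ldist (fine (n + 1) M) (bpt (n + 1) M b y) (bpt (n + 1) M b' y') + ((n : ℝ) + 1) := by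
      field_simp
    rw [e2]
    linarith
  -- assemble the sup
  have hc : 0 ≤ edist n M (bpt (n + 1) M b y) (bpt (n + 1) M b' y') + 1 := by linarith
  have hnat : ∀ i, circAbs (M i) (((b i).val : ℤ) - ((b' i).val : ℤ))
      ≤ (⌊edist n M (bpt (n + 1) M b y) (bpt (n + 1) M b' y') + 1⌋₊ : ℕ) := by
    intro i
    have h1 : circAbs (M i) (((b i).val : ℤ) - ((b' i).val : ℤ))
        ≤ ⌊edist n M (bpt (n + 1) M b y) (bpt (n + 1) M b' y') + 1⌋ := Int.le_floor.mpr (hcoord i)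
    rwa [← Int.natCast_floor_eq_floor hc] at h1
  exact (ldist_le_of_forall M hnat).trans (Nat.floor_le hc)

/-- **the block–block matrix element of `G₀` decays**: for `0 ≤ δ ≤ 1` with the `η`-free smallness,
`|Σ_{x∈B(b)} (G₀ 1_{B(b′)})(x)| ≤ (n+1)^d (2/min(2,a)) e^{−δ(ldist_M(b,b′) − 1)}` — `ℓ²` set decay + Cauchy–Schwarz
(`‖1_B‖₂² = (n+1)^d`); no pointwise bound on `G₀` is used. [folklore] -/
theorem blockSum_G0_abs_le (h3 : ∀ μ, 3 ≤ fine (n + 1) M μ) {a δ : ℝ} (ha : 0 < a) (hδ0 : 0 ≤ δ) (hδ1 : δ ≤ 1)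
    (hsmall : 2 * (d : ℝ) * δ ^ 2 + a * (Real.exp δ - 1) ≤ min 2 a / 2) (b b' : Tor M) :
    |∑ x ∈ univ.filter (fun x => B5Blocks16.blockOf (n + 1) M x = b), (G0 n M a).mulVec (ind n M b') x|
      ≤ ((n : ℝ) + 1) ^ d * (2 / min 2 a) * Real.exp (-(δ * (ldist M b b' - 1))) := by
  classical
  have hσ : 0 < min 2 a := lt_min two_pos ha
  set S := univ.filter (fun x => B5Blocks16.blockOf (n + 1) M x = b) with hS
  set T := univ.filter (fun x => B5Blocks16.blockOf (n + 1) M x = b') with hT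
  set v := (G0 n M a).mulVec (ind n M b') with hv
  set Rr := ldist M b b' - 1 with hRr
  have hTne : T.Nonempty := by
    rw [← Finset.card_pos, hT, card_block]; positivity
  have hdec := G0_setDecay n M h3 ha hδ0 hδ1 hsmall S T hTne Rr
    (fun x hx t ht => by
      rw [hS, Finset.mem_filter] at hx
      rw [hT, Finset.mem_filter] at ht
      have := ldist_blocks_le n M b b' hx.2 ht.2
      rw [hRr]; linarith)
    (ind n M b')
    (fun x hx => by
      rw [hT, Finset.mem_filter] at hx
      simp only [ind_apply]
      rw [if_neg (fun h => hx ⟨Finset.mem_univ _, h⟩)])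
  have hg2 : ∑ x, (ind n M b' x) ^ 2 = ((n : ℝ) + 1) ^ d := by
    simp only [ind_apply]
    rw [sum_blockInd_sq n M b', card_block]; push_cast; ring
  have hScard : (S.card : ℝ) = ((n : ℝ) + 1) ^ d := by rw [hS, card_block]; push_cast; ring
  have hCS : (∑ x ∈ S, v x) ^ 2 ≤ (S.card : ℝ) * ∑ x ∈ S, (v x) ^ 2 := by
    have h := Finset.sum_mul_sq_le_sq_mul_sq S (fun _ => (1 : ℝ)) v
    simp only [one_mul, one_pow, Finset.sum_const, nsmul_eq_mul, mul_one] at h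
    exact h
  set Bnd := ((n : ℝ) + 1) ^ d * (2 / min 2 a) * Real.exp (-(δ * Rr)) with hBnd
  have hBnd0 : 0 ≤ Bnd := by positivity
  have hexp : Real.exp (-(2 * (δ * Rr))) = Real.exp (-(δ * Rr)) ^ 2 := by
    rw [sq, ← Real.exp_add]; ring_nf
  have hsq : (∑ x ∈ S, v x) ^ 2 ≤ Bnd ^ 2 := by
    calc (∑ x ∈ S, v x) ^ 2 ≤ (S.card : ℝ) * ∑ x ∈ S, (v x) ^ 2 := hCS
      _ ≤ ((n : ℝ) + 1) ^ d * ((2 / min 2 a) ^ 2 * Real.exp (-(2 * (δ * Rr))) * ((n : ℝ) + 1) ^ d) := by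
          rw [hScard, ← hg2]
          exact mul_le_mul_of_nonneg_left hdec (by rw [hg2]; positivity)
      _ = Bnd ^ 2 := by rw [hBnd, hexp]; ring
  exact abs_le_of_sq_le_sq hsq hBnd0

/-- **(K2) ENTRY DECAY OF `K_eff`, UNIFORM IN THE MESH `η = 1/(n+1)` AND IN THE PERIODS**: for `a > 0`,
periods `≥ 3`, `0 ≤ δ ≤ 1` with `2dδ² + a(e^δ − 1) ≤ min(2,a)/2`:
`|K_eff(b,b′) − a δ_{bb′}| ≤ a² (2/min(2,a)) e^{δ} e^{−δ·ldist_M(b,b′)}`. [folklore] -/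
theorem Keff_entry_bound (h3 : ∀ μ, 3 ≤ fine (n + 1) M μ) {a δ : ℝ} (ha : 0 < a) (hδ0 : 0 ≤ δ) (hδ1 : δ ≤ 1)
    (hsmall : 2 * (d : ℝ) * δ ^ 2 + a * (Real.exp δ - 1) ≤ min 2 a / 2) (b b' : Tor M) :
    |Keff n M a b b' - (if b = b' then a else 0)|
      ≤ a ^ 2 * (2 / min 2 a) * Real.exp δ * Real.exp (-(δ * ldist M b b')) := by
  have hm : (0 : ℝ) < ((n : ℝ) + 1) ^ d := by positivity
  have h := blockSum_G0_abs_le n M h3 ha hδ0 hδ1 hsmall b b'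
  rw [Keff_apply]
  have e : (if b = b' then a else 0) - a ^ 2 / ((n : ℝ) + 1) ^ d
        * ∑ x ∈ univ.filter (fun x => B5Blocks16.blockOf (n + 1) M x = b), (G0 n M a).mulVec (ind n M b') x
        - (if b = b' then a else 0)
      = -(a ^ 2 / ((n : ℝ) + 1) ^ d
        * ∑ x ∈ univ.filter (fun x => B5Blocks16.blockOf (n + 1) M x = b), (G0 n M a).mulVec (ind n M b') x) := by
    ring
  rw [e, abs_neg, abs_mul, abs_of_nonneg (by positivity : (0 : ℝ) ≤ a ^ 2 / ((n : ℝ) + 1) ^ d)]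
  have hexp : Real.exp (-(δ * (ldist M b b' - 1))) = Real.exp δ * Real.exp (-(δ * ldist M b b')) := by
    rw [← Real.exp_add]; ring_nf
  calc a ^ 2 / ((n : ℝ) + 1) ^ d
        * |∑ x ∈ univ.filter (fun x => B5Blocks16.blockOf (n + 1) M x = b), (G0 n M a).mulVec (ind n M b') x|
      ≤ a ^ 2 / ((n : ℝ) + 1) ^ d * (((n : ℝ) + 1) ^ d * (2 / min 2 a) * Real.exp (-(δ * (ldist M b b' - 1)))) :=
        mul_le_mul_of_nonneg_left h (by positivity)
    _ = a ^ 2 * (2 / min 2 a) * Real.exp δ * Real.exp (-(δ * ldist M b b')) := by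
        rw [hexp]; field_simp

/-- pointwise consequence: `|K_eff(b,b′)| ≤ a δ_{bb′} + a²(2/min(2,a)) e^{δ} e^{−δ ldist_M(b,b′)}`. [folklore] -/
theorem Keff_abs_le (h3 : ∀ μ, 3 ≤ fine (n + 1) M μ) {a δ : ℝ} (ha : 0 < a) (hδ0 : 0 ≤ δ) (hδ1 : δ ≤ 1)
    (hsmall : 2 * (d : ℝ) * δ ^ 2 + a * (Real.exp δ - 1) ≤ min 2 a / 2) (b b' : Tor M) :
    |Keff n M a b b'| ≤ (if b = b' then a else 0) + a ^ 2 * (2 / min 2 a) * Real.exp δ * Real.exp (-(δ * ldist M b b')) := by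
  have h := Keff_entry_bound n M h3 ha hδ0 hδ1 hsmall b b'
  have hd : |(if b = b' then a else 0 : ℝ)| = (if b = b' then a else 0) := abs_of_nonneg (by split_ifs <;> linarith)
  calc |Keff n M a b b'| = |(Keff n M a b b' - (if b = b' then a else 0)) + (if b = b' then a else 0)| := by ring_nf
    _ ≤ |Keff n M a b b' - (if b = b' then a else 0)| + |(if b = b' then a else 0 : ℝ)| := abs_add_le _ _
    _ ≤ _ := by rw [hd]; linarith

/-! ## §5  (K3) Row moments, uniform in `k` and in the volume -/

/-- `toSite` (coordinates as `Fin`-valued sites) is injective. [folklore] -/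
theorem toSite_injective {N : Fin d → ℕ} [∀ μ, NeZero (N μ)] : Function.Injective (toSite N) := by
  intro x x' h
  funext i
  have hi := congrFun h i
  simp only [TorusG0Decay.toSite, Fin.mk.injEq] at hi
  exact ZMod.val_injective _ hi

/-- **period-free exponential sums on the unit torus**: `Σ_{b′} e^{−c·ldist_M(b,b′)} ≤ K_d(c)` for `c > 0`
(pv09's `B4Sect5Torus.torusSum_le`, pulled back along `toSite`). [folklore] -/
theorem sum_exp_ldist_le (b : Tor M) {c : ℝ} (hc : 0 < c) :
    ∑ b', Real.exp (-(c * ldist M b b')) ≤ latticeConst d c := by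
  classical
  have h := torusSum_le d (one_le M) hc (toSite M b)
  have e : ∑ b', Real.exp (-(c * ldist M b b'))
      = ∑ y ∈ univ.image (toSite M), Real.exp (-(c * tdist M (toSite M b) y)) := by
    rw [Finset.sum_image (fun x _ x' _ hxx' => toSite_injective hxx')]
    rfl
  rw [e]
  exact (Finset.sum_le_sum_of_subset_of_nonneg (Finset.subset_univ _) fun y _ _ => (Real.exp_pos _).le).trans h

/-- **(K3) WEIGHTED ROW SUMS**: for `δ > 0` as in (K2) and any weight `0 ≤ w(b,b′) ≤ C_w e^{(δ/2)·ldist_M(b,b′)}`,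
`Σ_{b′} |K_eff(b,b′)| w(b,b′) ≤ a·w(b,b) + a²(2/min(2,a)) e^{δ} C_w K_d(δ/2)`, uniformly in the mesh and the periods —
covers the `moment` fields of `ParametrixInputsW` (weight `ρ(1+P)`) and `TwoLegInputs` (weight `P`). [folklore] -/
theorem Keff_weighted_rowsum (h3 : ∀ μ, 3 ≤ fine (n + 1) M μ) {a δ : ℝ} (ha : 0 < a) (hδ : 0 < δ) (hδ1 : δ ≤ 1)
    (hsmall : 2 * (d : ℝ) * δ ^ 2 + a * (Real.exp δ - 1) ≤ min 2 a / 2)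
    (w : Tor M → Tor M → ℝ) {Cw : ℝ} (hw0 : ∀ b b', 0 ≤ w b b')
    (hw : ∀ b b', w b b' ≤ Cw * Real.exp (δ / 2 * ldist M b b')) (b : Tor M) :
    ∑ b', |Keff n M a b b'| * w b b'
      ≤ a * w b b + a ^ 2 * (2 / min 2 a) * Real.exp δ * Cw * latticeConst d (δ / 2) := by
  classical
  have hσ : 0 < min 2 a := lt_min two_pos ha
  have hA : 0 ≤ a ^ 2 * (2 / min 2 a) * Real.exp δ := by positivity
  -- termwise bound
  have hterm : ∀ b', |Keff n M a b b'| * w b b'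
      ≤ (if b = b' then a else 0) * w b b'
        + a ^ 2 * (2 / min 2 a) * Real.exp δ * Cw * Real.exp (-(δ / 2 * ldist M b b')) := by
    intro b'
    have h1 := Keff_abs_le n M h3 ha hδ.le hδ1 hsmall b b'
    have h2 : |Keff n M a b b'| * w b b' ≤ ((if b = b' then a else 0)
        + a ^ 2 * (2 / min 2 a) * Real.exp δ * Real.exp (-(δ * ldist M b b'))) * w b b' :=
      mul_le_mul_of_nonneg_right h1 (hw0 b b')
    have h3' : Real.exp (-(δ * ldist M b b')) * w b b' ≤ Cw * Real.exp (-(δ / 2 * ldist M b b')) := by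
      calc Real.exp (-(δ * ldist M b b')) * w b b'
          ≤ Real.exp (-(δ * ldist M b b')) * (Cw * Real.exp (δ / 2 * ldist M b b')) :=
            mul_le_mul_of_nonneg_left (hw b b') (Real.exp_pos _).le
        _ = Cw * Real.exp (-(δ / 2 * ldist M b b')) := by
            rw [mul_comm, mul_assoc, ← Real.exp_add]; ring_nf
    calc |Keff n M a b b'| * w b b' ≤ _ := h2
      _ = (if b = b' then a else 0) * w b b'
          + a ^ 2 * (2 / min 2 a) * Real.exp δ * (Real.exp (-(δ * ldist M b b')) * w b b') := by ring
      _ ≤ (if b = b' then a else 0) * w b b'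
          + a ^ 2 * (2 / min 2 a) * Real.exp δ * (Cw * Real.exp (-(δ / 2 * ldist M b b'))) := by
          gcongr
      _ = _ := by ring
  refine (Finset.sum_le_sum fun b' _ => hterm b').trans ?_
  rw [Finset.sum_add_distrib, ← Finset.mul_sum]
  have hdiag : ∑ b', (if b = b' then a else 0) * w b b' = a * w b b := by
    simp only [ite_mul, zero_mul, Finset.sum_ite_eq, Finset.mem_univ, if_true]
  rw [hdiag]
  have hCw : 0 ≤ Cw := by
    have := (hw0 b b).trans (hw b b)
    rw [ldist_self, mul_zero, Real.exp_zero, mul_one] at this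
    exact this
  have hsum := sum_exp_ldist_le M b (half_pos hδ)
  gcongr

/-- polynomial weights are exponentially dominated: `(1 + t)^q ≤ q! (2/δ)^q e^{δ/2} · e^{(δ/2) t}` for `t ≥ 0`, `δ > 0`
(from `x^q/q! ≤ e^x`). [folklore] -/
theorem one_add_pow_le_exp (q : ℕ) {δ : ℝ} (hδ : 0 < δ) {t : ℝ} (ht : 0 ≤ t) :
    (1 + t) ^ q ≤ (q.factorial : ℝ) * (2 / δ) ^ q * Real.exp (δ / 2) * Real.exp (δ / 2 * t) := by
  have hx : 0 ≤ δ / 2 * (1 + t) := by positivity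
  have h := Real.pow_div_factorial_le_exp (δ / 2 * (1 + t)) hx q
  have hq : (0 : ℝ) < q.factorial := by exact_mod_cast Nat.factorial_pos q
  rw [div_le_iff₀ hq, mul_pow] at h
  have hδq : (0 : ℝ) < (δ / 2) ^ q := by positivity
  have e : Real.exp (δ / 2 * (1 + t)) = Real.exp (δ / 2) * Real.exp (δ / 2 * t) := by
    rw [← Real.exp_add]; ring_nf
  rw [e] at h
  calc (1 + t) ^ q = ((δ / 2) ^ q * (1 + t) ^ q) * (2 / δ) ^ q := by
        rw [mul_comm ((δ / 2) ^ q), mul_assoc, ← mul_pow]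
        rw [show δ / 2 * (2 / δ) = 1 by field_simp, one_pow, mul_one]
    _ ≤ (Real.exp (δ / 2) * Real.exp (δ / 2 * t) * q.factorial) * (2 / δ) ^ q :=
        mul_le_mul_of_nonneg_right h (by positivity)
    _ = _ := by ring

/-- the explicit row-moment constant `κ_q(d,a,δ) = a + a²(2/min(2,a)) e^{3δ/2} q! (2/δ)^q K_d(δ/2)`. [folklore] -/
def kappaRow (d q : ℕ) (a δ : ℝ) : ℝ :=
  a + a ^ 2 * (2 / min 2 a) * Real.exp δ * ((q.factorial : ℝ) * (2 / δ) ^ q * Real.exp (δ / 2)) * latticeConst d (δ / 2)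

/-- **(K3) ROW MOMENTS OF EVERY ORDER, UNIFORM IN `k` AND IN THE VOLUME**:
`Σ_{b′} |K_eff(b,b′)| (1 + ldist_M(b,b′))^q ≤ κ_q(d,a,δ)` for every unit site `b`, every mesh `η = 1/(n+1)` and every
period vector — the `moment` field of `Beta/BulkParametrix.TwoLegInputs` with `P y y′ = (1 + ldist y y′)^q`. [folklore] -/
theorem Keff_moment (h3 : ∀ μ, 3 ≤ fine (n + 1) M μ) {a δ : ℝ} (ha : 0 < a) (hδ : 0 < δ) (hδ1 : δ ≤ 1)
    (hsmall : 2 * (d : ℝ) * δ ^ 2 + a * (Real.exp δ - 1) ≤ min 2 a / 2) (q : ℕ) (b : Tor M) :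
    ∑ b', |Keff n M a b b'| * (1 + ldist M b b') ^ q ≤ kappaRow d q a δ := by
  have hl0 : ∀ b b' : Tor M, 0 ≤ ldist M b b' := fun b b' => by
    unfold TorusG0Decay.ldist; exact tdist_nonneg _ _ _
  have h := Keff_weighted_rowsum n M h3 ha hδ hδ1 hsmall (fun b b' => (1 + ldist M b b') ^ q)
    (Cw := (q.factorial : ℝ) * (2 / δ) ^ q * Real.exp (δ / 2))
    (fun b b' => pow_nonneg (by linarith [hl0 b b']) q) (fun b b' => one_add_pow_le_exp q hδ (hl0 b b')) b
  simp only [ldist_self, add_zero, one_pow, mul_one] at h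
  rw [kappaRow]
  linarith

/-! ## §6  (K4) `0 ≤ K_eff ≤ a` as quadratic forms -/

/-- the fine quadratic form splits: `⟨f, H f⟩ = ⟨f, (−Δ^η) f⟩ + (a/(n+1)^d) ‖ind f‖²`. [folklore] -/
theorem torusOp_form_eq (a : ℝ) (f : Tor (fine (n + 1) M) → ℝ) :
    f ⬝ᵥ (torusOp n M a).mulVec f
      = f ⬝ᵥ (lap (coupling (fine (n + 1) M) (((n : ℝ) + 1) ^ 2))).mulVec f
        + a / ((n : ℝ) + 1) ^ d * ((ind n M).mulVec f ⬝ᵥ (ind n M).mulVec f) := by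
  rw [torusOp_eq, Matrix.add_mulVec, Matrix.smul_mulVec, dotProduct_add, dotProduct_smul, smul_eq_mul,
    ← Matrix.mulVec_mulVec, Matrix.dotProduct_mulVec f (ind n M)ᵀ, Matrix.vecMul_transpose]

/-- `−Δ^η ≥ 0`. [folklore] -/
theorem lap_form_nonneg (f : Tor (fine (n + 1) M) → ℝ) :
    0 ≤ f ⬝ᵥ (lap (coupling (fine (n + 1) M) (((n : ℝ) + 1) ^ 2))).mulVec f := by
  rw [lap_form _ (coupling_symm _ _)]
  refine div_nonneg (Finset.sum_nonneg fun j _ => Finset.sum_nonneg fun k _ =>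
    mul_nonneg (coupling_nonneg _ (by positivity) _ _) (sq_nonneg _)) two_pos.le

/-- the variational bound behind the Schur complement: `⟨indᵀψ, G₀ indᵀψ⟩ ≤ ((n+1)^d/a) ‖ψ‖²`. [folklore] -/
theorem indG0ind_form_le (h3 : ∀ μ, 3 ≤ fine (n + 1) M μ) {a : ℝ} (ha : 0 < a) (ψ : Tor M → ℝ) :
    ψ ⬝ᵥ (ind n M * G0 n M a * (ind n M)ᵀ).mulVec ψ ≤ ((n : ℝ) + 1) ^ d / a * (ψ ⬝ᵥ ψ) := by
  have hm : (0 : ℝ) < ((n : ℝ) + 1) ^ d := by positivity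
  set u := ((ind n M)ᵀ).mulVec ψ with hu
  set f₀ := (G0 n M a).mulVec u with hf₀
  set w := (ind n M).mulVec f₀ with hw
  -- the form is `t := ψ ⬝ w = u ⬝ f₀`
  have ht1 : ψ ⬝ᵥ (ind n M * G0 n M a * (ind n M)ᵀ).mulVec ψ = ψ ⬝ᵥ w := by
    rw [hw, hf₀, hu, Matrix.mulVec_mulVec, Matrix.mulVec_mulVec]
  have ht2 : ψ ⬝ᵥ w = u ⬝ᵥ f₀ := by
    rw [hw, Matrix.dotProduct_mulVec, ← Matrix.mulVec_transpose]
  -- `u ⬝ f₀ = ⟨f₀, H f₀⟩ ≥ (a/(n+1)^d) ‖w‖²`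
  have hH : u ⬝ᵥ f₀ = f₀ ⬝ᵥ (torusOp n M a).mulVec f₀ := by
    rw [hf₀, torusOp_mulVec_G0 n M h3 ha, dotProduct_comm]
  have hlow : a / ((n : ℝ) + 1) ^ d * (w ⬝ᵥ w) ≤ u ⬝ᵥ f₀ := by
    rw [hH, torusOp_form_eq, ← hw]
    linarith [lap_form_nonneg n M f₀]
  -- Cauchy–Schwarz `(ψ ⬝ w)² ≤ ‖ψ‖² ‖w‖²`
  have hCS : (ψ ⬝ᵥ w) ^ 2 ≤ (ψ ⬝ᵥ ψ) * (w ⬝ᵥ w) := by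
    have h := Finset.sum_mul_sq_le_sq_mul_sq univ ψ w
    have e1 : ψ ⬝ᵥ ψ = ∑ i, ψ i ^ 2 := Finset.sum_congr rfl fun i _ => by ring
    have e2 : w ⬝ᵥ w = ∑ i, w i ^ 2 := Finset.sum_congr rfl fun i _ => by ring
    rw [e1, e2]; exact h
  have hψ0 : 0 ≤ ψ ⬝ᵥ ψ := Finset.sum_nonneg fun i _ => mul_self_nonneg _
  have hw0 : 0 ≤ w ⬝ᵥ w := Finset.sum_nonneg fun i _ => mul_self_nonneg _
  set t := ψ ⬝ᵥ w with htdef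
  rw [ht1]
  rw [← ht2] at hlow
  -- from `(a/m) ‖w‖² ≤ t` and `t² ≤ ‖ψ‖² ‖w‖²`: `t ≤ (m/a) ‖ψ‖²`
  by_cases ht0 : t ≤ 0
  · exact ht0.trans (by positivity)
  · have ht0 : 0 < t := lt_of_not_ge ht0
    have h1 : a / ((n : ℝ) + 1) ^ d * t ^ 2 ≤ (ψ ⬝ᵥ ψ) * t := by
      calc a / ((n : ℝ) + 1) ^ d * t ^ 2 ≤ a / ((n : ℝ) + 1) ^ d * ((ψ ⬝ᵥ ψ) * (w ⬝ᵥ w)) :=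
            mul_le_mul_of_nonneg_left hCS (by positivity)
        _ = (ψ ⬝ᵥ ψ) * (a / ((n : ℝ) + 1) ^ d * (w ⬝ᵥ w)) := by ring
        _ ≤ (ψ ⬝ᵥ ψ) * t := mul_le_mul_of_nonneg_left hlow hψ0
    have h2 : a / ((n : ℝ) + 1) ^ d * t ≤ ψ ⬝ᵥ ψ := by
      refine le_of_mul_le_mul_right ?_ ht0
      calc a / ((n : ℝ) + 1) ^ d * t * t = a / ((n : ℝ) + 1) ^ d * t ^ 2 := by ring
        _ ≤ (ψ ⬝ᵥ ψ) * t := h1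
    calc t = ((n : ℝ) + 1) ^ d / a * (a / ((n : ℝ) + 1) ^ d * t) := by field_simp
      _ ≤ ((n : ℝ) + 1) ^ d / a * (ψ ⬝ᵥ ψ) := mul_le_mul_of_nonneg_left h2 (by positivity)

/-- **(K4) `K_eff ≥ 0`** as a quadratic form, for every `a > 0`. [folklore] -/
theorem Keff_form_nonneg (h3 : ∀ μ, 3 ≤ fine (n + 1) M μ) {a : ℝ} (ha : 0 < a) (ψ : Tor M → ℝ) :
    0 ≤ ψ ⬝ᵥ (Keff n M a).mulVec ψ := by
  have hm : (0 : ℝ) < ((n : ℝ) + 1) ^ d := by positivity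
  have h := indG0ind_form_le n M h3 ha ψ
  rw [Keff, Matrix.sub_mulVec, Matrix.smul_mulVec, Matrix.smul_mulVec, Matrix.one_mulVec, dotProduct_sub,
    dotProduct_smul, dotProduct_smul, smul_eq_mul, smul_eq_mul]
  have h2 : a ^ 2 / ((n : ℝ) + 1) ^ d * (ψ ⬝ᵥ (ind n M * G0 n M a * (ind n M)ᵀ).mulVec ψ) ≤ a * (ψ ⬝ᵥ ψ) := by
    calc a ^ 2 / ((n : ℝ) + 1) ^ d * (ψ ⬝ᵥ (ind n M * G0 n M a * (ind n M)ᵀ).mulVec ψ)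
        ≤ a ^ 2 / ((n : ℝ) + 1) ^ d * (((n : ℝ) + 1) ^ d / a * (ψ ⬝ᵥ ψ)) :=
          mul_le_mul_of_nonneg_left h (by positivity)
      _ = a * (ψ ⬝ᵥ ψ) := by field_simp
  linarith

/-- **(K4) `K_eff ≤ a`** as a quadratic form (`Q G₀ Q* ≥ 0`). [folklore] -/
theorem Keff_form_le (h3 : ∀ μ, 3 ≤ fine (n + 1) M μ) {a : ℝ} (ha : 0 < a) (ψ : Tor M → ℝ) :
    ψ ⬝ᵥ (Keff n M a).mulVec ψ ≤ a * (ψ ⬝ᵥ ψ) := by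
  have hm : (0 : ℝ) < ((n : ℝ) + 1) ^ d := by positivity
  rw [Keff, Matrix.sub_mulVec, Matrix.smul_mulVec, Matrix.smul_mulVec, Matrix.one_mulVec, dotProduct_sub,
    dotProduct_smul, dotProduct_smul, smul_eq_mul, smul_eq_mul]
  have h0 : 0 ≤ ψ ⬝ᵥ (ind n M * G0 n M a * (ind n M)ᵀ).mulVec ψ := by
    rw [← Matrix.mulVec_mulVec, ← Matrix.mulVec_mulVec, Matrix.dotProduct_mulVec ψ (ind n M),
      ← Matrix.mulVec_transpose]
    exact G0_form_nonneg n M h3 ha _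
  have : 0 ≤ a ^ 2 / ((n : ℝ) + 1) ^ d * (ψ ⬝ᵥ (ind n M * G0 n M a * (ind n M)ᵀ).mulVec ψ) := by positivity
  linarith

/-! ## §7  Non-vacuity: an admissible rate `δ` for every `a > 0` -/

/-- an explicit admissible rate: `δ_std(d,a) = min(2,a) / (4(d + a + 1))`. [folklore] -/
def deltaStd (d : ℕ) (a : ℝ) : ℝ := min 2 a / (4 * ((d : ℝ) + a + 1))

/-- `δ_std > 0`. [folklore] -/
theorem deltaStd_pos {a : ℝ} (ha : 0 < a) : 0 < deltaStd d a := by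
  unfold deltaStd
  have : 0 < min 2 a := lt_min two_pos ha
  positivity

/-- `δ_std ≤ 1`. [folklore] -/
theorem deltaStd_le_one {a : ℝ} (ha : 0 < a) : deltaStd d a ≤ 1 := by
  unfold deltaStd
  have h2 : min 2 a ≤ 2 := min_le_left _ _
  have hd : (0 : ℝ) ≤ d := Nat.cast_nonneg d
  rw [div_le_one (by positivity)]
  linarith

/-- **`δ_std` satisfies the `η`-free smallness condition** `2dδ² + a(e^δ − 1) ≤ min(2,a)/2` (using `e^δ − 1 ≤ δ + δ² ≤ 2δ`
for `0 ≤ δ ≤ 1`). [folklore] -/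
theorem deltaStd_small {a : ℝ} (ha : 0 < a) :
    2 * (d : ℝ) * deltaStd d a ^ 2 + a * (Real.exp (deltaStd d a) - 1) ≤ min 2 a / 2 := by
  set δ := deltaStd d a with hδ
  have hδ0 : 0 < δ := deltaStd_pos (d := d) ha
  have hδ1 : δ ≤ 1 := deltaStd_le_one (d := d) ha
  have hσ : 0 < min 2 a := lt_min two_pos ha
  have hd : (0 : ℝ) ≤ d := Nat.cast_nonneg d
  have hexp : Real.exp δ - 1 ≤ 2 * δ := by
    have h := Real.abs_exp_sub_one_sub_id_le (x := δ) (by rw [abs_of_pos hδ0]; exact hδ1)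
    rw [abs_le] at h
    have : δ ^ 2 ≤ δ := by nlinarith
    nlinarith [h.2]
  have hsq : δ ^ 2 ≤ δ := by nlinarith
  have hkey : δ * (4 * ((d : ℝ) + a + 1)) = min 2 a := by
    rw [hδ, deltaStd]; field_simp
  have hA : 2 * (d : ℝ) * δ ^ 2 ≤ 2 * (d : ℝ) * δ := mul_le_mul_of_nonneg_left hsq (by positivity)
  have hB : a * (Real.exp δ - 1) ≤ a * (2 * δ) := mul_le_mul_of_nonneg_left hexp ha.le
  calc 2 * (d : ℝ) * δ ^ 2 + a * (Real.exp δ - 1) ≤ 2 * (d : ℝ) * δ + a * (2 * δ) := add_le_add hA hB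
    _ = (2 * ((d : ℝ) + a)) * δ := by ring
    _ ≤ (2 * ((d : ℝ) + a + 1)) * δ := mul_le_mul_of_nonneg_right (by linarith) hδ0.le
    _ = min 2 a / 2 := by rw [← hkey]; ring

/-- **(K2) at the standard rate**: for every `a > 0`, periods `≥ 3`, every mesh:
`|K_eff(b,b′) − aδ_{bb′}| ≤ a²(2/min(2,a)) e · e^{−δ_std(d,a)·ldist_M(b,b′)}` (using `e^{δ_std} ≤ e`). [folklore] -/
theorem Keff_entry_bound_std (h3 : ∀ μ, 3 ≤ fine (n + 1) M μ) {a : ℝ} (ha : 0 < a) (b b' : Tor M) :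
    |Keff n M a b b' - (if b = b' then a else 0)|
      ≤ a ^ 2 * (2 / min 2 a) * Real.exp 1 * Real.exp (-(deltaStd d a * ldist M b b')) := by
  have h := Keff_entry_bound n M h3 ha (deltaStd_pos (d := d) ha).le (deltaStd_le_one (d := d) ha)
    (deltaStd_small (d := d) ha) b b'
  have hσ : 0 < min 2 a := lt_min two_pos ha
  refine h.trans ?_
  gcongr
  exact deltaStd_le_one (d := d) ha

/-- **(K3) at the standard rate**: `Σ_{b′} |K_eff(b,b′)| (1 + ldist_M(b,b′))^q ≤ κ_q(d, a, δ_std(d,a))` for every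
`a > 0`, uniformly in the mesh and the periods. [folklore] -/
theorem Keff_moment_std (h3 : ∀ μ, 3 ≤ fine (n + 1) M μ) {a : ℝ} (ha : 0 < a) (q : ℕ) (b : Tor M) :
    ∑ b', |Keff n M a b b'| * (1 + ldist M b b') ^ q ≤ kappaRow d q a (deltaStd d a) :=
  Keff_moment n M h3 ha (deltaStd_pos (d := d) ha) (deltaStd_le_one (d := d) ha) (deltaStd_small (d := d) ha) q b

end

/-! ## Sanity instances -/

section Sanity
open B5Prop11Plancherel (fine)

/-- the period hypothesis of every theorem above holds e.g. in `d = 4` for the unit mesh `n = 0` and periods `M = 3`,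
and for `n = 1` (mesh `1/2`) with `M = 2`. -/
example : ∀ μ : Fin 4, 3 ≤ fine (0 + 1) (fun _ : Fin 4 => 3) μ := fun μ => by show 3 ≤ (0 + 1) * 3; norm_num
example : ∀ μ : Fin 4, 3 ≤ fine (1 + 1) (fun _ : Fin 4 => 2) μ := fun μ => by show 3 ≤ (1 + 1) * 2; norm_num

/-- the standard rate at `d = 4`, `a = 1` is `δ_std = 1/24`. -/
example : deltaStd 4 1 = 1 / 24 := by
  rw [deltaStd, min_eq_right (by norm_num : (1 : ℝ) ≤ 2)]; norm_num

end Sanity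

end Literature.MathematicalPhysics.QuantumFieldTheory.Balaban1983to89.Beta.EffectiveKernel
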